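import Mathlib
import HarnessLib
import Summits.NavierStokesRegularity.NavierStokesRegularity.Theorems.RellichScarAxisymmetricApexFatal
import Literature.Analysis.FluidPDE.SuitableWeakInBallTools
import Literature.Analysis.FluidPDE.ESSLocalHolderBlowupLimit
import Literature.Analysis.FluidPDE.LocalTypeIScaling
import Literature.Analysis.FluidPDE.EulerTimeScaling
import Literature.Analysis.FluidPDE.KNSSThm53OfWindow
import Literature.Analysis.FluidPDE.NSLerayHopfSereginMild

/-!
# `AxisymEndLiouvilleOfFarPastLedger` (stmt-NavierStokesRegularity-14736), 𝒦-route endgame: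
# an axisymmetric Type-I suitable weak solution in a parabolic ball is regular at the vertex

The last step of the blow-down argument for the axisymmetric leaf in Albritton–Barker's class 𝒦
(route SymmetryModuliCount, item text: "PersistenceOfSingularities_holds makes (0,0) a backward
singular point of v̄ — contradicting AxisymmetricTypeIExclusion_holds"): if `(u, p)` is a
suitable weak solution of Navier–Stokes (`ν = 1`) in a parabolic ball `Q(0, R)` (Albritton–Barker
2019, Def. 2.1, the output class of the compactness lemma `SuitableCompactness`), with
`u ∈ L³(Q(0, R))`, almost every point of `Q(0, R)` obeying the Type-I temporal bound
`√(−t)‖u‖ ≤ C` and the axisymmetry `R_θ u(t, R_θ⁻¹ x) = u(t, x)` (for every angle `θ`), then the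
vertex `(0, 0)` is NOT a backward singular point of `u` (`false_of_axisymmetric_typeI_singular`).

Proof: zoom out by the factor `R/2` (`IsSuitableWeakSolutionInBall.zoomOut`), so that the
Seregin–Šverák unit cylinder `𝒞 × ]-1,0[ ⊆ Q(0, 2)` fits (`ssCylinder_subset_parabolicCylinder_two`);
the a.e. hypotheses and the singularity transport along the parabolic dilation
(`ae_restrict_preimage_stAffine`, `eLpNorm_top_nsZoom`); Haar averaging
(`exists_axisymmetric_ae_eq`, applied to the zero extension of the zoomed field) gives an exactly
axisymmetric representative; Seregin–Šverák 2009, Thm 3.1 (= Thm 1.1), PROVED in the tree as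
`Literature.Barriers.NavierStokesRegularity.AxisymmetricTypeIExclusion_holds`, makes the vertex
regular, contradicting `IsBackwardSingularPoint`. This generalises the tree's
`rellichScar_axisymmetricApexFatal_proof` (which assumes a suitable weak solution on the whole
backward slab with `𝐈 < ∞` and the space–time apex bound) to the ball-local, temporal-rate data a
blow-down limit actually has.

## References

* G. Seregin, V. Šverák, Comm. PDE 34 (2009), 171–201, Thm 3.1 (= Thm 1.1). [SereginSverak2009]
* D. Albritton, T. Barker, J. Math. Fluid Mech. 21 (2019), Def. 2.1, Lemma 2.2, Prop. 2.3.
  [AlbrittonBarker2019]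
-/

noncomputable section

-- the summit and its single problem share the name (D-0017 nested layout)
set_option linter.dupNamespace false

open MeasureTheory Set Metric Filter Function TopologicalSpace
open scoped ENNReal NNReal Topology

namespace Summit.NavierStokesRegularity.NavierStokesRegularity.Theorems.AxisymEndLiouvilleOfFarPastLedger

open Literature.Analysis.FluidPDE Literature.Barriers.NavierStokesRegularity
open Summit.NavierStokesRegularity.NavierStokesRegularity.Theorems

/-- A point of the backward slab stays in / out of the parabolic ball `Q(0, r)` under a rotation
of its space component (the ball is centred on the axis). [folklore] -/
theorem mem_parabolicCylinder_rotZ_iff (θ r : ℝ) (z : ℝ × EuclideanSpace ℝ (Fin 3)) :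
    ((z.1, rotZ θ z.2) : ℝ × EuclideanSpace ℝ (Fin 3)) ∈
        parabolicCylinder r (0 : ℝ × EuclideanSpace ℝ (Fin 3)) ↔
      z ∈ parabolicCylinder r (0 : ℝ × EuclideanSpace ℝ (Fin 3)) := by
  simp only [mem_parabolicCylinder, Prod.fst_zero, Prod.snd_zero, dist_zero_right, norm_rotZ]

/-- **𝒦-route endgame: an axisymmetric Type-I suitable weak solution in a parabolic ball is not
singular at the vertex.** Let `(u, p)` be a suitable weak solution of Navier–Stokes (`ν = 1`,
`f = 0`) in `Q(0, R)`, `R > 0`, in the class of Albritton–Barker 2019, Def. 2.1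
(`IsSuitableWeakSolutionInBall`), with `u ∈ L³(Q(0, R))`, a.e. axisymmetric about the `x₃`-axis on
`Q(0, R)` for every angle, and obeying the temporal Type-I bound `√(−t)‖u(t,x)‖ ≤ C` a.e. on
`Q(0, R)`. Then the vertex is not a backward singular point. (Zoom out by `R/2`; Haar-average to
an exactly axisymmetric representative; Seregin–Šverák 2009, Thm 3.1 on the unit cylinder
`𝒞 × ]-1,0[ ⊆ Q(0,2)` makes the vertex regular.) [cite: SereginSverak2009, Thm 3.1 (= Thm 1.1)] -/
theorem false_of_axisymmetric_typeI_singular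
    {u : ℝ → EuclideanSpace ℝ (Fin 3) → EuclideanSpace ℝ (Fin 3)}
    {p : ℝ → EuclideanSpace ℝ (Fin 3) → ℝ} {R C : ℝ} (hR : 0 < R)
    (hball : IsSuitableWeakSolutionInBall R 0 u p)
    (hL3 : MemLp (uncurry u) 3
      (volume.restrict (parabolicCylinder R (0 : ℝ × EuclideanSpace ℝ (Fin 3)))))
    (hsym : ∀ θ : ℝ, ∀ᵐ w ∂(volume.restrict (parabolicCylinder R (0 : ℝ × EuclideanSpace ℝ (Fin 3)))),
      rotZ θ (u w.1 (rotZ (-θ) w.2)) = u w.1 w.2)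
    (htypeI : ∀ᵐ w ∂(volume.restrict (parabolicCylinder R (0 : ℝ × EuclideanSpace ℝ (Fin 3)))),
      Real.sqrt (-w.1) * ‖u w.1 w.2‖ ≤ C)
    (hsing : IsBackwardSingularPoint u 0) : False := by
  -- ### Step 1: zoom out by `c = R/2`, onto the ball `Q(0, 2)`
  set c : ℝ := R / 2 with hc_def
  have hc : 0 < c := by positivity
  have hc2 : 0 < c ^ 2 := pow_pos hc 2
  have hRc : R / c = 2 := by
    rw [hc_def]; field_simp
  set U : ℝ → EuclideanSpace ℝ (Fin 3) → EuclideanSpace ℝ (Fin 3) :=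
    c • stPull (c ^ 2) c (0 : ℝ) (0 : EuclideanSpace ℝ (Fin 3)) u with hU
  set P : ℝ → EuclideanSpace ℝ (Fin 3) → ℝ :=
    c ^ 2 • stPull (c ^ 2) c (0 : ℝ) (0 : EuclideanSpace ℝ (Fin 3)) p with hP
  set S : Set (ℝ × EuclideanSpace ℝ (Fin 3)) :=
    parabolicCylinder 2 (0 : ℝ × EuclideanSpace ℝ (Fin 3)) with hS
  have hSm : MeasurableSet S := (isOpen_parabolicCylinder _ _).measurableSet
  have hball2 : IsSuitableWeakSolutionInBall 2 0 U P := by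
    have h := hball.zoomOut hc
    rwa [hRc] at h
  have hpre : stAffine (c ^ 2) c 0 (0 : EuclideanSpace ℝ (Fin 3)) ⁻¹'
      parabolicCylinder R (0 : ℝ × EuclideanSpace ℝ (Fin 3)) = S := by
    rw [stAffine_preimage_parabolicCylinder_zero hc R, hRc]
  have hUapply : ∀ (s : ℝ) (y : EuclideanSpace ℝ (Fin 3)),
      U s y = c • u (c ^ 2 * s) (c • y) := fun s y => by
    simp only [hU, smul_stPull_apply, zero_add]
  -- a.e. axisymmetry of the zoomed field on `S`
  have hsymU : ∀ θ : ℝ, ∀ᵐ w ∂(volume.restrict S), rotZ θ (U w.1 (rotZ (-θ) w.2)) = U w.1 w.2 := by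
    intro θ
    have h := ae_restrict_preimage_stAffine hc2 hc (0 : ℝ) (0 : EuclideanSpace ℝ (Fin 3)) (hsym θ)
    rw [hpre] at h
    filter_upwards [h] with w hw
    simp only [stAffine_fst, stAffine_snd, zero_add] at hw
    rw [hUapply, hUapply]
    rw [rotZ_smul (-θ) c w.2] at hw
    rw [rotZ_smul θ c, hw]
  -- the Type-I bound of the zoomed field on `S`
  have htypeIU : ∀ᵐ w ∂(volume.restrict S), Real.sqrt (-w.1) * ‖U w.1 w.2‖ ≤ C := by
    have h := ae_restrict_preimage_stAffine hc2 hc (0 : ℝ) (0 : EuclideanSpace ℝ (Fin 3)) htypeI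
    rw [hpre] at h
    filter_upwards [h] with w hw
    simp only [stAffine_fst, stAffine_snd, zero_add] at hw
    rw [hUapply, norm_smul, Real.norm_eq_abs, abs_of_pos hc]
    have e : Real.sqrt (-(c ^ 2 * w.1)) = c * Real.sqrt (-w.1) := by
      rw [show -(c ^ 2 * w.1) = c ^ 2 * (-w.1) by ring, Real.sqrt_mul (sq_nonneg c),
        Real.sqrt_sq hc.le]
    calc Real.sqrt (-w.1) * (c * ‖u (c ^ 2 * w.1) (c • w.2)‖)
        = c * Real.sqrt (-w.1) * ‖u (c ^ 2 * w.1) (c • w.2)‖ := by ring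
      _ = Real.sqrt (-(c ^ 2 * w.1)) * ‖u (c ^ 2 * w.1) (c • w.2)‖ := by rw [e]
      _ ≤ C := hw
  -- the vertex is still singular
  have hsingU : IsBackwardSingularPoint U 0 := by
    intro r hr
    have h0 : stAffine (c ^ 2) c 0 (0 : EuclideanSpace ℝ (Fin 3)) 0 = 0 := by
      ext <;> simp [stAffine]
    rw [hU, eLpNorm_top_nsZoom hc 0 (0 : EuclideanSpace ℝ (Fin 3)) r 0 u, h0,
      hsing (c * r) (by positivity), ENNReal.mul_top (ENNReal.ofReal_pos.2 hc).ne']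
  -- `U ∈ L³(S)`
  have hL3U : MemLp (uncurry U) 3 (volume.restrict S) := by
    have h1 := (memLp_comp_zoom hc (by norm_num) (by norm_num) hL3).const_smul c
    rw [hRc] at h1
    have e : uncurry U = c • (uncurry u ∘ stAffine (c ^ 2) c (0 : ℝ) (0 : EuclideanSpace ℝ (Fin 3))) := by
      funext z; rfl
    rw [e]
    exact h1
  -- ### Step 2: Haar averaging — an exactly axisymmetric representative of `U` on `S`
  set T : Set (ℝ × EuclideanSpace ℝ (Fin 3)) := Iio (0 : ℝ) ×ˢ (univ : Set (EuclideanSpace ℝ (Fin 3)))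
    with hT
  have hST : S ⊆ T := parabolicCylinder_subset_lowerHalf le_rfl 2
  set f : ℝ × EuclideanSpace ℝ (Fin 3) → EuclideanSpace ℝ (Fin 3) := S.indicator (uncurry U) with hf
  have hUm : AEStronglyMeasurable (uncurry U) (volume.restrict S) :=
    hball2.1.distributional.1.aestronglyMeasurable
  have hfm : AEStronglyMeasurable f (volume.restrict T) := by
    rw [hf, aestronglyMeasurable_indicator_iff hSm, Measure.restrict_restrict hSm,
      inter_eq_self_of_subset_left hST]
    exact hUm
  have hTsplit : T = S ∪ (T \ S) := by
    rw [union_sdiff_self, union_eq_self_of_subset_left hST]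
  have hsymf : ∀ θ : ℝ, (fun z : ℝ × EuclideanSpace ℝ (Fin 3) => rotZ θ (f (z.1, rotZ (-θ) z.2)))
      =ᵐ[volume.restrict T] f := by
    intro θ
    show ∀ᵐ z ∂(volume.restrict T), rotZ θ (f (z.1, rotZ (-θ) z.2)) = f z
    rw [hTsplit, ae_restrict_union_eq, eventually_sup]
    constructor
    · filter_upwards [hsymU θ, ae_restrict_mem hSm] with z hz hzS
      have hzS' : ((z.1, rotZ (-θ) z.2) : ℝ × EuclideanSpace ℝ (Fin 3)) ∈ S :=
        (mem_parabolicCylinder_rotZ_iff (-θ) 2 z).2 hzS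
      rw [hf, indicator_of_mem hzS', indicator_of_mem hzS]
      exact hz
    · filter_upwards [ae_restrict_mem (measurableSet_Iio.prod MeasurableSet.univ |>.diff hSm)]
        with z hz
      have hzS : z ∉ S := hz.2
      have hzS' : ((z.1, rotZ (-θ) z.2) : ℝ × EuclideanSpace ℝ (Fin 3)) ∉ S :=
        fun h => hzS ((mem_parabolicCylinder_rotZ_iff (-θ) 2 z).1 h)
      rw [hf, indicator_of_notMem hzS', indicator_of_notMem hzS]
      exact rotZ_apply_zero_vec θ
  obtain ⟨v, hvax, hv⟩ := exists_axisymmetric_ae_eq measurableSet_Iio hfm hsymf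
  -- `v = U` a.e. on `S`
  have hvS : ∀ᵐ z ∂(volume.restrict S), uncurry v z = uncurry U z := by
    have h1 : ∀ᵐ z ∂(volume.restrict S), uncurry v z = f z :=
      ae_restrict_of_ae_restrict_of_subset hST hv
    filter_upwards [h1, ae_restrict_mem hSm] with z hz hzS
    rw [hz, hf, indicator_of_mem hzS]
  -- ### Step 3: the hypotheses of Seregin–Šverák 2009, Thm 3.1 on the unit cylinder
  have hcyl2 : ssCylinder ⊆ S := ssCylinder_subset_parabolicCylinder_two
  have hvC : ∀ᵐ z ∂(volume.restrict ssCylinder), uncurry v z = uncurry U z :=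
    ae_restrict_of_ae_restrict_of_subset hcyl2 hvS
  have h1 : IsDistributionalNSSolutionOn ssCylinderOpens 1 0 v P := by
    have hle : ssCylinderOpens ≤ parabolicCylinderOpens 2 ((0 : ℝ), (0 : EuclideanSpace ℝ (Fin 3))) :=
      fun _ hz => hcyl2 hz
    have hd : IsDistributionalNSSolutionOn ssCylinderOpens 1 0 U P :=
      hball2.1.distributional.of_le hle
    refine hd.congr_ae ?_ (ae_of_all _ fun _ => rfl)
    filter_upwards [hvC] with z hz
    exact hz.symm
  have h2 : ∫⁻ z in ssCylinder, ‖v z.1 z.2‖ₑ ^ (3 : ℕ) < ∞ := by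
    have hfin : ∫⁻ z in S, ‖uncurry U z‖ₑ ^ (3 : ℝ≥0∞).toReal < ∞ :=
      lintegral_rpow_enorm_lt_top_of_eLpNorm_lt_top (by norm_num) (by norm_num) hL3U.eLpNorm_lt_top
    have e3 : (3 : ℝ≥0∞).toReal = ((3 : ℕ) : ℝ) := by norm_num
    rw [e3] at hfin
    simp only [ENNReal.rpow_natCast] at hfin
    calc ∫⁻ z in ssCylinder, ‖v z.1 z.2‖ₑ ^ (3 : ℕ)
        = ∫⁻ z in ssCylinder, ‖U z.1 z.2‖ₑ ^ (3 : ℕ) := by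
          refine lintegral_congr_ae ?_
          filter_upwards [hvC] with z hz
          simp only [uncurry] at hz
          rw [hz]
      _ ≤ ∫⁻ z in S, ‖U z.1 z.2‖ₑ ^ (3 : ℕ) := lintegral_mono_set hcyl2
      _ < ∞ := hfin
  have h3 : ∫⁻ z in ssCylinder, ‖P z.1 z.2‖ₑ ^ (3 / 2 : ℝ) < ∞ := by
    obtain ⟨h32, h32', h32r⟩ := threeHalves_facts
    have hmem : MemLp (uncurry P) (3 / 2) (volume.restrict S) := hball2.2.2.2
    have hfin := lintegral_rpow_enorm_lt_top_of_eLpNorm_lt_top (zero_lt_one.trans_le h32).ne' h32'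
      hmem.eLpNorm_lt_top
    rw [h32r] at hfin
    exact lt_of_le_of_lt (lintegral_mono_set hcyl2) hfin
  have h4 : ∀ t ∈ Ioo (-1 : ℝ) 0, IsAxisymmetric (v t) := fun t _ => hvax t
  have h5 : ∃ C' : ℝ, ∀ᵐ z ∂(volume.restrict ssCylinder), Real.sqrt (-z.1) * ‖v z.1 z.2‖ ≤ C' := by
    refine ⟨C, ?_⟩
    filter_upwards [ae_restrict_of_ae_restrict_of_subset hcyl2 htypeIU, hvC] with z hz hvz
    simp only [uncurry] at hvz
    rw [hvz]
    exact hz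
  -- ### Step 4: the vertex is regular for `v`, hence for `U` — contradiction
  obtain ⟨r, hr, hbd⟩ := AxisymmetricTypeIExclusion_holds v P h1 h2 h3 h4 h5
  set r' : ℝ := min r 2 with hr'
  have hr'0 : 0 < r' := lt_min hr two_pos
  have hsub' : parabolicCylinder r' ((0 : ℝ), (0 : EuclideanSpace ℝ (Fin 3))) ⊆ S :=
    parabolicCylinder_subset_of_le hr'0.le (min_le_right _ _) _
  have hsubr : parabolicCylinder r' ((0 : ℝ), (0 : EuclideanSpace ℝ (Fin 3))) ⊆
      parabolicCylinder r ((0 : ℝ), (0 : EuclideanSpace ℝ (Fin 3))) :=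
    parabolicCylinder_subset_of_le hr'0.le (min_le_left _ _) _
  have heq : eLpNorm (uncurry U) ∞ (volume.restrict (parabolicCylinder r' ((0 : ℝ), (0 : EuclideanSpace ℝ (Fin 3))))) =
      eLpNorm (uncurry v) ∞ (volume.restrict (parabolicCylinder r' ((0 : ℝ), (0 : EuclideanSpace ℝ (Fin 3))))) :=
    eLpNorm_congr_ae (ae_restrict_of_ae_restrict_of_subset hsub' (by
      filter_upwards [hvS] with z hz using hz.symm))
  have hle : eLpNorm (uncurry v) ∞ (volume.restrict (parabolicCylinder r' ((0 : ℝ), (0 : EuclideanSpace ℝ (Fin 3))))) ≤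
      eLpNorm (uncurry v) ∞ (volume.restrict (parabolicCylinder r ((0 : ℝ), (0 : EuclideanSpace ℝ (Fin 3))))) :=
    eLpNorm_mono_measure _ (Measure.restrict_mono hsubr le_rfl)
  have hinf : eLpNorm (uncurry U) ∞ (volume.restrict (parabolicCylinder r' ((0 : ℝ), (0 : EuclideanSpace ℝ (Fin 3))))) = ∞ :=
    hsingU r' hr'0
  rw [hinf] at heq
  exact lt_irrefl _ ((heq.le.trans hle).trans_lt hbd)

end Summit.NavierStokesRegularity.NavierStokesRegularity.Theorems.AxisymEndLiouvilleOfFarPastLedger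

end
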